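import Summits.Ventures.YMGap.RobustBall.MassGapOnBallZdG
import Summits.Ventures.YMGap.RobustBall.MassGapOnBallS
import Summits.Ventures.YMGap.RobustBall.StarDoorZd
import HarnessLib

/-!
# Venture YMGap, track ROBUST-BALL (tier 2, `ℤ^d`) — THE STATEMENT of crux Y2-X2-WZd: the GAUGE-INVARIANT
# DIAMETER-WEIGHTED `ℤ^d` ball `MemBallZdW κ ε₀ ε₁`, its target type `MassGapOnBallZdW`, and truncation

HONEST FRAMING. WHAT THIS IS: a venture file (cell `pub-ymgap`, track Y2 ROBUST-BALL, seat ds-2) fixing the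
TYPE of the tier-2 `ℤ^d` theorem of the robust vertex-star door (proved in `RobustStarDoorZdW.lean`):
* `MemBallZdW κ ε₀ ε₁ W` — MEMBERSHIP in the `ℤ^d` reading of the directive's torus ball `ClusterDomain κ ε₀ ε₁`
  (`RobustBall/Defs.lean`): gauge-invariant continuous own-link terms `W_X` (ALL finite link sets `X`, no range,
  no support list), a summable link majorant (rb-p1's `IsLinkSummable`, so that the summable specification
  `perturbedYMS` is defined), and DIAMETER-WEIGHTED per-link loads — oscillation
  `Σ'_{X ∋ e} e^{κ·diam X} osc_X(e) ≤ ε₀` and, by SITE incidence (as `MemBallZdG`), Lipschitz mass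
  `Σ'_{X based at v} e^{κ·diam X} Σ_{y ∈ X} Lip_y(W_X) ≤ ε₁` (`diam` = the `ℓ^∞` diameter of base points, `linkDiamZd`);
* `MassGapOnBallZdW d N β κ ε₀ ε₁` — THE TARGET TYPE: every member has rb-p1's tier-2 mass gap
  `PerturbedMassGapAtS d N β W` (exactly one DLR state of `perturbedYMS`, Shen–Zhu–Zhu clustering);
* the TRUNCATION `truncZd D s W` of a member to the link sets inside the radius-`D` box around the vertex `s`
  (`starNbhdZdR D s`) with its support family `truncSuppZd D s`: a member of the gauge-invariant TIER-1 ball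
  `MemBallZdG ε₀ ε₁ (2D)` for every `κ ≥ 0` (`MemBallZdW.truncZd_mem`) — the object through which the chart
  machinery of crux Y2-X2-Zd (`RobustStarDoorZd.lean`) is reused star by star; the complementary FAR family
  (sets meeting the star of `s` but leaving the box) has diameter `≥ D` (`le_linkDiamZd_of_far`).
Nothing is asserted by the definitions. WHAT IT IS NOT: no door, no number; nothing about the continuum.
-/

noncomputable section

open MeasureTheory Function Finset
open scoped NNReal
open Literature.Probability.LatticeModels
open Literature.Probability.LatticeModels.DobrushinMetric
open Literature.MathematicalPhysics.QuantumLattice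
open Literature.MathematicalPhysics.QuantumFieldTheory hiding ZdEdge
open Summit.Ventures.YMGap.DSWindowZd

namespace Summit.Ventures.YMGap.RobustBall

variable {d N : ℕ}

/-! ### The `ℓ^∞` diameter of a finite link set -/

/-- The `ℓ^∞` diameter of the base points of a finite link set (a natural number; `0` for `∅`). [folklore] -/
def linkDiamZd (X : Finset (ZdEdge d)) : ℕ := (X ×ˢ X).sup fun p => supNormZd (p.1.1 - p.2.1)

/-- Two links of `X` have base points within `linkDiamZd X` (integer form). [folklore] -/
theorem supNormZd_sub_le_linkDiamZd {X : Finset (ZdEdge d)} {a b : ZdEdge d} (ha : a ∈ X) (hb : b ∈ X) :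
    supNormZd (a.1 - b.1) ≤ linkDiamZd X := by
  have hab : (a, b) ∈ X ×ˢ X := Finset.mem_product.2 ⟨ha, hb⟩
  exact Finset.le_sup (f := fun p : ZdEdge d × ZdEdge d => supNormZd (p.1.1 - p.2.1)) hab

/-- Two links of `X` have base points within `linkDiamZd X` (real sup-norm form). [folklore] -/
theorem norm_sub_le_linkDiamZd {X : Finset (ZdEdge d)} {a b : ZdEdge d} (ha : a ∈ X) (hb : b ∈ X) :
    ‖a.1 - b.1‖ ≤ (linkDiamZd X : ℝ) := by
  refine norm_le_of_natAbs_le fun i => ?_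
  have h := natAbs_le_supNormZd (a.1 - b.1) i
  exact h.trans (supNormZd_sub_le_linkDiamZd ha hb)

/-! ### The gauge-invariant diameter-weighted ball and the target -/

/-- **Membership in the tier-2 gauge-invariant `ℤ^d` ball** of weight `κ` and loads `(ε₀, ε₁)`: continuous
gauge-invariant terms depending on their own links, a summable link majorant, oscillation witnesses with
`Σ'_{X ∋ e} e^{κ·diam X} osc_X(e) ≤ ε₀` at every link `e`, and Frobenius-Lipschitz witnesses with the
SITE-incidence load `Σ'_{X based at v} e^{κ·diam X} Σ_{y ∈ X} lip_X(y) ≤ ε₁` at every site `v` (`X` based at `v`: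
`X` contains an outgoing link `(v, μ)`). The `ℤ^d` reading of the torus ball `ClusterDomain κ ε₀ ε₁`. [folklore] -/
structure MemBallZdW (κ ε₀ ε₁ : ℝ) (W : Potential (ZdEdge d) (SUN N)) : Prop where
  /-- every term is continuous -/
  continuous : ∀ X, Continuous (W X)
  /-- every term depends only on the links of its set -/
  dependsOn : ∀ X, DependsOn (W X) (↑X : Set (ZdEdge d))
  /-- every term is gauge invariant -/
  gaugeInvariant : ∀ X, IsZdGaugeInvariant (W X)
  /-- a summable link majorant -/
  summable : ∃ B, IsLinkSummable W B
  /-- the diameter-weighted loads -/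
  loads : ∃ osc lip : Finset (ZdEdge d) → ZdEdge d → ℝ,
    (∀ X, Dobrushin.IsOscBound (W X) (osc X)) ∧ (∀ X, IsLipBound suFrobDist (W X) (lip X)) ∧
      (∀ e, Summable fun X : Finset (ZdEdge d) =>
        (if e ∈ X then Real.exp (κ * linkDiamZd X) * osc X e else 0)) ∧
      (∀ e, ∑' X : Finset (ZdEdge d),
        (if e ∈ X then Real.exp (κ * linkDiamZd X) * osc X e else 0) ≤ ε₀) ∧
      (∀ v : Site d, Summable fun X : Finset (ZdEdge d) =>
        (if (∃ μ : Fin d, ((v, μ) : ZdEdge d) ∈ X) then Real.exp (κ * linkDiamZd X) * ∑ y ∈ X, lip X y else 0)) ∧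
      (∀ v : Site d, ∑' X : Finset (ZdEdge d),
        (if (∃ μ : Fin d, ((v, μ) : ZdEdge d) ∈ X) then Real.exp (κ * linkDiamZd X) * ∑ y ∈ X, lip X y else 0)
          ≤ ε₁)

/-- The ball is monotone in its loads. [folklore] -/
theorem MemBallZdW.mono {κ ε₀ ε₁ ε₀' ε₁' : ℝ} {W : Potential (ZdEdge d) (SUN N)} (h : MemBallZdW κ ε₀ ε₁ W)
    (h₀ : ε₀ ≤ ε₀') (h₁ : ε₁ ≤ ε₁') : MemBallZdW κ ε₀' ε₁' W := by
  obtain ⟨osc, lip, h1, h2, h3, h4, h5, h6⟩ := h.loads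
  exact ⟨h.continuous, h.dependsOn, h.gaugeInvariant, h.summable, osc, lip, h1, h2, h3,
    fun e => (h4 e).trans h₀, h5, fun v => (h6 v).trans h₁⟩

/-- The zero potential is a member of every ball with nonnegative loads (the centre: Wilson). [folklore] -/
theorem memBallZdW_zero {κ ε₀ ε₁ : ℝ} (h₀ : 0 ≤ ε₀) (h₁ : 0 ≤ ε₁) : MemBallZdW (d := d) (N := N) κ ε₀ ε₁ 0 where
  continuous _ := continuous_const
  dependsOn _ _ _ _ := rfl
  gaugeInvariant _ _ _ := rfl
  summable := ⟨fun _ => 0, fun _ _ => by simp, fun _ => by simp⟩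
  loads := ⟨fun _ _ => 0, fun _ _ => 0, fun _ => ⟨fun _ => le_rfl, fun _ _ _ _ => by simp⟩,
    fun _ => ⟨fun _ => le_rfl, fun _ _ _ _ => by simp⟩, fun _ => by simp, fun _ => by simpa using h₀,
    fun _ => by simp, fun _ => by simpa using h₁⟩

variable (d N) in
/-- **THE TIER-2 `ℤ^d` TARGET TYPE OF THE STAR DOOR — mass gap uniformly on the gauge-invariant
diameter-weighted ball**: every member of `MemBallZdW κ ε₀ ε₁` has rb-p1's tier-2 mass gap
`PerturbedMassGapAtS d N β W` ('t Hooft coupling `β`). Nothing is asserted by the definition. [folklore] -/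
def MassGapOnBallZdW (β κ ε₀ ε₁ : ℝ) : Prop :=
  ∀ W : Potential (ZdEdge d) (SUN N), MemBallZdW κ ε₀ ε₁ W → PerturbedMassGapAtS d N β W

/-- The ball theorem contains the Wilson theorem: `MassGapOnBallZdW d N β κ ε₀ ε₁ → PerturbedMassGapAtS d N β 0`
(`0 ≤ ε₀, ε₁`). [folklore] -/
theorem MassGapOnBallZdW.wilson {β κ ε₀ ε₁ : ℝ} (h : MassGapOnBallZdW d N β κ ε₀ ε₁) (h₀ : 0 ≤ ε₀)
    (h₁ : 0 ≤ ε₁) : PerturbedMassGapAtS d N β 0 :=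
  h 0 (memBallZdW_zero h₀ h₁)

/-! ### Truncation to the box around a vertex: a tier-1 member -/

/-- **Truncation of a potential to the radius-`D` box around the vertex `s`**: keep the terms of the link
sets inside `starNbhdZdR D s` (links based within sup-distance `D` of `s`), drop the rest. [folklore] -/
def truncZd (D : ℕ) (s : Site d) (W : Potential (ZdEdge d) (SUN N)) : Potential (ZdEdge d) (SUN N) :=
  fun X => if X ⊆ starNbhdZdR D s then W X else 0

/-- The support family of the truncation: the subsets of the box meeting the volume. [folklore] -/
def truncSuppZd (D : ℕ) (s : Site d) (Λ : Finset (ZdEdge d)) : Finset (Finset (ZdEdge d)) :=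
  (starNbhdZdR D s).powerset.filter fun X => (X ∩ Λ).Nonempty

/-- The truncation agrees with `W` on the sets inside the box … [folklore] -/
theorem truncZd_of_subset {D : ℕ} {s : Site d} {W : Potential (ZdEdge d) (SUN N)} {X : Finset (ZdEdge d)}
    (hX : X ⊆ starNbhdZdR D s) : truncZd D s W X = W X := by
  simp only [truncZd, if_pos hX]

/-- … and vanishes on the others. [folklore] -/
theorem truncZd_of_not_subset {D : ℕ} {s : Site d} {W : Potential (ZdEdge d) (SUN N)} {X : Finset (ZdEdge d)}
    (hX : ¬ X ⊆ starNbhdZdR D s) : truncZd D s W X = 0 := by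
  simp only [truncZd, if_neg hX]

/-- Membership in the truncation support family. [folklore] -/
theorem mem_truncSuppZd {D : ℕ} {s : Site d} {Λ X : Finset (ZdEdge d)} :
    X ∈ truncSuppZd D s Λ ↔ X ⊆ starNbhdZdR D s ∧ (X ∩ Λ).Nonempty := by
  simp only [truncSuppZd, Finset.mem_filter, Finset.mem_powerset]

/-- The truncation is supported by its support family. [folklore] -/
theorem isSupportedBy_truncZd (D : ℕ) (s : Site d) (W : Potential (ZdEdge d) (SUN N)) :
    (truncZd D s W).IsSupportedBy (truncSuppZd D s) := by
  classical
  intro Λ A hA hne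
  by_cases hAs : A ⊆ starNbhdZdR D s
  · exact mem_truncSuppZd.2 ⟨hAs, hA⟩
  · exact absurd (truncZd_of_not_subset hAs) hne

/-- A link of the radius-`D` box is based within sup-distance `D` of the vertex. [folklore] -/
theorem norm_sub_le_of_mem_starNbhdZdR {D : ℕ} {s : Site d} {y : ZdEdge d} (hy : y ∈ starNbhdZdR D s) :
    ‖y.1 - s‖ ≤ (D : ℝ) :=
  norm_le_of_natAbs_le fun i => by
    have h := (mem_starNbhdZdR.1 hy) i
    rwa [Pi.sub_apply]

/-- Two links of the radius-`D` box are within sup-distance `2D` of each other. [folklore] -/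
theorem norm_sub_le_of_mem_starNbhdZdR_of_mem {D : ℕ} {s : Site d} {e y : ZdEdge d}
    (he : e ∈ starNbhdZdR D s) (hy : y ∈ starNbhdZdR D s) : ‖e.1 - y.1‖ ≤ ((2 * D : ℕ) : ℝ) := by
  have h1 := norm_sub_le_of_mem_starNbhdZdR he
  have h2 := norm_sub_le_of_mem_starNbhdZdR hy
  calc ‖e.1 - y.1‖ = ‖(e.1 - s) - (y.1 - s)‖ := by congr 1; abel
    _ ≤ ‖e.1 - s‖ + ‖y.1 - s‖ := norm_sub_le _ _
    _ ≤ ((2 * D : ℕ) : ℝ) := by push_cast; linarith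

/-- **The truncation of a tier-2 member is a tier-1 member**: for `κ ≥ 0`, every `D` and every vertex `s`,
`(truncZd D s W, truncSuppZd D s) ∈ MemBallZdG ε₀ ε₁ (2D)` — the unweighted loads of the kept terms are
dominated by the weighted loads of all terms. [folklore] -/
theorem MemBallZdW.truncZd_mem {κ ε₀ ε₁ : ℝ} {W : Potential (ZdEdge d) (SUN N)} (hκ : 0 ≤ κ)
    (h : MemBallZdW κ ε₀ ε₁ W) (D : ℕ) (s : Site d) :
    MemBallZdG ε₀ ε₁ (2 * D) (truncZd D s W) (truncSuppZd D s) := by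
  classical
  obtain ⟨osc, lip, hosc, hlip, hoscs, hosca, hlips, hlipa⟩ := h.loads
  have hw1 : ∀ X : Finset (ZdEdge d), 1 ≤ Real.exp (κ * linkDiamZd X) := fun X =>
    Real.one_le_exp (mul_nonneg hκ (Nat.cast_nonneg _))
  refine ⟨fun X => ?_, fun X => ?_, isSupportedBy_truncZd D s W, fun e X hX _ y hy => ?_, fun X => ?_,
    fun X e => if X ⊆ starNbhdZdR D s then osc X e else 0,
    fun X y => if X ⊆ starNbhdZdR D s then lip X y else 0, fun X => ?_, fun X => ?_, fun e => ?_, fun v => ?_⟩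
  · by_cases hX : X ⊆ starNbhdZdR D s
    · rw [show truncZd D s W X = W X from truncZd_of_subset hX]; exact h.continuous X
    · rw [show truncZd D s W X = 0 from truncZd_of_not_subset hX]; exact continuous_const
  · by_cases hX : X ⊆ starNbhdZdR D s
    · rw [show truncZd D s W X = W X from truncZd_of_subset hX]; exact h.dependsOn X
    · rw [show truncZd D s W X = 0 from truncZd_of_not_subset hX]; exact fun _ _ _ => rfl
  · obtain ⟨hXs, -⟩ := mem_truncSuppZd.1 hX
    have he : e ∈ X := by assumption
    exact norm_sub_le_of_mem_starNbhdZdR_of_mem (hXs he) (hXs hy)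
  · by_cases hX : X ⊆ starNbhdZdR D s
    · rw [show truncZd D s W X = W X from truncZd_of_subset hX]; exact h.gaugeInvariant X
    · rw [show truncZd D s W X = 0 from truncZd_of_not_subset hX]; exact fun _ _ => rfl
  · by_cases hX : X ⊆ starNbhdZdR D s
    · rw [show truncZd D s W X = W X from truncZd_of_subset hX]
      refine ⟨fun e => ?_, fun e σ τ hστ => ?_⟩
      · simp only [if_pos hX]; exact (hosc X).nonneg e
      · simp only [if_pos hX]; exact (hosc X).le e σ τ hστ
    · rw [show truncZd D s W X = 0 from truncZd_of_not_subset hX]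
      refine ⟨fun e => ?_, fun e σ τ _ => ?_⟩
      · simp only [if_neg hX]; exact le_rfl
      · simp only [if_neg hX, Pi.zero_apply, sub_self, abs_zero]; exact le_rfl
  · by_cases hX : X ⊆ starNbhdZdR D s
    · rw [show truncZd D s W X = W X from truncZd_of_subset hX]
      refine ⟨fun y => ?_, fun y σ τ hστ => ?_⟩
      · simp only [if_pos hX]; exact (hlip X).nonneg y
      · simp only [if_pos hX]; exact (hlip X).le y σ τ hστ
    · rw [show truncZd D s W X = 0 from truncZd_of_not_subset hX]
      refine ⟨fun y => ?_, fun y σ τ _ => ?_⟩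
      · simp only [if_neg hX]; exact le_rfl
      · simp only [if_neg hX, Pi.zero_apply, sub_self, abs_zero, zero_mul]; exact le_rfl
  · -- oscillation load: the kept terms through `e`, unweighted, against the weighted series
    calc ∑ X ∈ (truncSuppZd D s {e}).filter (fun X => e ∈ X), (if X ⊆ starNbhdZdR D s then osc X e else 0)
        ≤ ∑ X ∈ (truncSuppZd D s {e}).filter (fun X => e ∈ X),
            (if e ∈ X then Real.exp (κ * linkDiamZd X) * osc X e else 0) := by
          refine Finset.sum_le_sum fun X hX => ?_
          have heX : e ∈ X := (Finset.mem_filter.1 hX).2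
          rw [if_pos heX]
          split_ifs
          · calc osc X e = 1 * osc X e := (one_mul _).symm
              _ ≤ Real.exp (κ * linkDiamZd X) * osc X e :=
                mul_le_mul_of_nonneg_right (hw1 X) ((hosc X).nonneg e)
          · exact mul_nonneg (Real.exp_nonneg _) ((hosc X).nonneg e)
      _ ≤ ∑' X, (if e ∈ X then Real.exp (κ * linkDiamZd X) * osc X e else 0) :=
          (hoscs e).sum_le_tsum _ fun X _ => by
            split_ifs
            · exact mul_nonneg (Real.exp_nonneg _) ((hosc X).nonneg e)
            · exact le_rfl
      _ ≤ ε₀ := hosca e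
  · -- site-incidence Lipschitz load at `v`
    have hterm : ∀ X ∈ listedAt (truncSuppZd D s) v,
        ∑ y ∈ X, (if X ⊆ starNbhdZdR D s then lip X y else 0) ≤
          (if (∃ μ : Fin d, ((v, μ) : ZdEdge d) ∈ X) then Real.exp (κ * linkDiamZd X) * ∑ y ∈ X, lip X y
            else 0) := by
      intro X hX
      obtain ⟨μ, -, hμX⟩ := mem_listedAt.1 hX
      rw [if_pos ⟨μ, hμX⟩]
      have hs0 : 0 ≤ ∑ y ∈ X, lip X y := Finset.sum_nonneg fun y _ => (hlip X).nonneg y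
      split_ifs
      · calc ∑ y ∈ X, lip X y = 1 * ∑ y ∈ X, lip X y := (one_mul _).symm
          _ ≤ Real.exp (κ * linkDiamZd X) * ∑ y ∈ X, lip X y := mul_le_mul_of_nonneg_right (hw1 X) hs0
      · rw [Finset.sum_const_zero]; exact mul_nonneg (Real.exp_nonneg _) hs0
    calc ∑ X ∈ listedAt (truncSuppZd D s) v, ∑ y ∈ X, (if X ⊆ starNbhdZdR D s then lip X y else 0)
        ≤ ∑ X ∈ listedAt (truncSuppZd D s) v,
            (if (∃ μ : Fin d, ((v, μ) : ZdEdge d) ∈ X) then Real.exp (κ * linkDiamZd X) * ∑ y ∈ X, lip X y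
              else 0) := Finset.sum_le_sum hterm
      _ ≤ ∑' X, (if (∃ μ : Fin d, ((v, μ) : ZdEdge d) ∈ X) then
            Real.exp (κ * linkDiamZd X) * ∑ y ∈ X, lip X y else 0) :=
          (hlips v).sum_le_tsum _ fun X _ => by
            split_ifs
            · exact mul_nonneg (Real.exp_nonneg _) (Finset.sum_nonneg fun y _ => (hlip X).nonneg y)
            · exact le_rfl
      _ ≤ ε₁ := hlipa v

/-! ### The far family of a vertex: the sets meeting its star and leaving the box -/

/-- **A set meeting the star of `s` and leaving the radius-`D` box has diameter `≥ D`** (`D ≥ 1`): it contains a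
star link (based within `1` of `s`) and a link based farther than `D` from `s`. [folklore] -/
theorem le_linkDiamZd_of_far {D : ℕ} {s : Site d} {X : Finset (ZdEdge d)} {x : ZdEdge d}
    (hx : x ∈ vertexStarZd s) (hxX : x ∈ X) (hX : ¬ X ⊆ starNbhdZdR D s) : (D : ℝ) ≤ linkDiamZd X := by
  classical
  obtain ⟨z, hzX, hz⟩ := Finset.not_subset.1 hX
  -- some coordinate of `z.1 - s` exceeds `D`
  obtain ⟨i, hi⟩ : ∃ i, D < (z.1 i - s i).natAbs := by
    by_contra hcon
    exact hz (mem_starNbhdZdR.2 fun i => not_lt.1 fun h => hcon ⟨i, h⟩)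
  have h1 : (x.1 i - s i).natAbs ≤ 1 := natAbs_sub_le_one_of_mem_vertexStarZd hx i
  have h2 : D ≤ (x.1 i - z.1 i).natAbs := by omega
  have h3 : (x.1 i - z.1 i).natAbs ≤ supNormZd (x.1 - z.1) := by
    have := natAbs_le_supNormZd (x.1 - z.1) i
    rwa [Pi.sub_apply] at this
  have h4 := supNormZd_sub_le_linkDiamZd hxX hzX
  exact_mod_cast h2.trans (h3.trans h4)

end Summit.Ventures.YMGap.RobustBall

end
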